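import Summits.AtomisticToContinuum.BoseEinsteinCondensation.Theorems.BECInsertionCorrectorStaticResponseBoundFewBodyPerturbative
import Summits.AtomisticToContinuum.BoseEinsteinCondensation.Theorems.BECInsertionCorrectorStaticResponseBoundModulationToolkit
import Summits.AtomisticToContinuum.BoseEinsteinCondensation.Theorems.BECConjugateDominationHardCoreExtensionBoundedPositiveMinimiserHolds
import HarnessLib

/-!
# The few-body half of the static response bound, II: assembly of `FewBodyBounded`
# (registered stub `stub_fewBodyBounded_of_parts`, line `stable-fraction-square-completion`, seat c2 layer;
# item stmt-AtomisticToContinuum-12057 — this file supports, does not close, the item)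

For every BOUNDED admissible pair potential `w`, every `N`, `L > 0` in the few-body regime `N·E₀(w,N,L)·L² ≤ 4π²/5`,
every `k ≠ 0`, every coupling `t` and every finite-energy periodic trial state `Ψ`:

  `E₀(w,N,L) − 10 t² N/|p|² ≤ E_w(Ψ) + t ⟨∑ⱼ cos(p·xⱼ)⟩_Ψ`,

from the four registered analytic stubs of the layer, taken as hypotheses (texts inlined): the gauged free square
(`stub_gaugedSquare`), the complex ground-state representation (`stub_complexGsRep`), the weighted gap
(`stub_weightedGap`) and the mode-pairing bound (`stub_modePairing`).

Proof. `N = 0` is trivial. For `N ≥ 1` take the positive `C¹` ground state `Φ₀` of the bounded potential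
(`boundedPositiveMinimiser_holds`), replaced by its half-wavelength translate if necessary so that `t⟨V⟩_{Φ₀} ≥ 0`
(`exists_translate_cosMean_eq_neg`); `λ = E₀`, `g = (2π/L)² − 2λ ≥ (3/5)(2π/L)²`.
* Weak coupling `2|t|N ≤ g`: write `Ψ = (θ₁ + iθ₂)|Φ₀|`; by the complex ground-state representation
  `E_w(Ψ) + t⟨V⟩_Ψ − λ = ∑ᵢ [𝓔(θᵢ) + t∫Vθᵢ²|Φ₀|²]`, and each bracket is `≥ −10t²(N/|p|²)∫θᵢ²|Φ₀|²` by
  `fewBody_perturbative_real` (part I); the weights sum to `1`.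
* Otherwise `|t| > g/(2N) ≥ (3/2)λ`, and the gauged square gives
  `E_w(Ψ) + t⟨V⟩_Ψ ≥ e^{−4|t|N/|p|²}λ − Nt²/|p|² ≥ λ − (4|t|Nλ + Nt²)/|p|² ≥ λ − 10t²N/|p|²`.
-/

noncomputable section

namespace Summit.AtomisticToContinuum.BoseEinsteinCondensation.Cruxes.StaticResponseBound.FewBody

open MeasureTheory Filter
open scoped ENNReal NNReal BigOperators Topology
open Literature.MathematicalPhysics.QuantumManyBody.BoseGas
open Summit.AtomisticToContinuum.BoseEinsteinCondensation.Theses.BECInsertionCorrector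
open Summit.AtomisticToContinuum.BoseEinsteinCondensation.Theorems.StaticResponseBound.Negative
open Summit.AtomisticToContinuum.BoseEinsteinCondensation.Cruxes.StaticResponseBound.UvThomsonForceWave
open Summit.AtomisticToContinuum.BoseEinsteinCondensation.Cruxes.HardCoreExtension.ThirdLawCurrentFloor

variable {N : ℕ} {L : ℝ}

/-! ## Two lemmas of real arithmetic -/

/-- The strong-coupling case: from the gauged square `e^{−x}λ − Nt²/|p|² ≤ E` (`x = 4|t|N/|p|²`) and `4λ ≤ 9|t|`,
`λ − 10t²N/|p|² ≤ E` (`e^{−x} ≥ 1 − x`). [folklore] -/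
theorem gaugedCase_algebra {E lam t Nr psq : ℝ} (hpsq : 0 < psq) (hN : 0 ≤ Nr) (hlam : 0 ≤ lam)
    (hGS : Real.exp (-(4 * |t| * Nr / psq)) * lam - Nr * t ^ 2 / psq ≤ E) (hkey : 4 * lam ≤ 9 * |t|) :
    lam - 10 * t ^ 2 * Nr / psq ≤ E := by
  have hexp : 1 - 4 * |t| * Nr / psq ≤ Real.exp (-(4 * |t| * Nr / psq)) := by
    linarith [Real.add_one_le_exp (-(4 * |t| * Nr / psq))]
  have h1 : (1 - 4 * |t| * Nr / psq) * lam ≤ Real.exp (-(4 * |t| * Nr / psq)) * lam :=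
    mul_le_mul_of_nonneg_right hexp hlam
  -- `4|t|Nr·lam ≤ 9 t² Nr`
  have h2 : 4 * |t| * Nr * lam ≤ 9 * t ^ 2 * Nr := by
    have htt : |t| * |t| = t ^ 2 := by rw [abs_mul_abs_self, sq]
    nlinarith [mul_le_mul_of_nonneg_left hkey (mul_nonneg (abs_nonneg t) hN), abs_nonneg t]
  have h3 : 4 * |t| * Nr * lam / psq ≤ 9 * t ^ 2 * Nr / psq := div_le_div_of_nonneg_right h2 hpsq.le
  have e1 : (1 - 4 * |t| * Nr / psq) * lam = lam - 4 * |t| * Nr * lam / psq := by ring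
  have e2 : lam - 10 * t ^ 2 * Nr / psq = lam - 9 * t ^ 2 * Nr / psq - Nr * t ^ 2 / psq := by ring
  rw [e2]
  rw [e1] at h1
  linarith

/-- The few-body bookkeeping: from `N·λ·L² ≤ 4π²/5`, `N ≥ 1`, `λ ≥ 0`: `N λ ≤ (2π/L)²/5` and `5λ ≤ (2π/L)²`. [folklore] -/
theorem fewBody_bookkeeping {lam L Nr : ℝ} (hL : 0 < L) (hN : 1 ≤ Nr) (hlam : 0 ≤ lam)
    (hE : Nr * lam * L ^ 2 ≤ 4 * Real.pi ^ 2 / 5) :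
    Nr * lam ≤ (2 * Real.pi / L) ^ 2 / 5 ∧ 5 * lam ≤ (2 * Real.pi / L) ^ 2 := by
  have hL2 : 0 < L ^ 2 := by positivity
  have h1 : Nr * lam ≤ (2 * Real.pi / L) ^ 2 / 5 := by
    rw [show (2 * Real.pi / L) ^ 2 / 5 = (4 * Real.pi ^ 2 / 5) / L ^ 2 by field_simp; ring]
    rw [le_div_iff₀ hL2]
    exact hE
  refine ⟨h1, ?_⟩
  have : lam ≤ Nr * lam := by nlinarith
  linarith

/-! ## The assembly -/

/-- **Registered stub `stub_fewBodyBounded_of_parts` (the lead's stub of the seat-c2 layer): `FewBodyBounded` from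
`GaugedSquare`, `ComplexGsRep`, `WeightedGap` and `ModePairing`** (texts inlined, in this order).  See the file header
for the proof. [cite: ReedSimonIV1978, §XII.2; Kato1966, VII §4] -/
theorem stub_fewBodyBounded_of_parts :
    (∀ (v : ℝ → ℝ≥0∞) (N : ℕ) (L : ℝ), 0 < L → ∀ (k : Fin 3 → ℤ), k ≠ 0 →
      ∀ (t : ℝ) (Ψ : PeriodicTrialState N L), periodicEnergy v Ψ ≠ ⊤ →
        Real.exp (-(4 * |t| * N / psq L k)) * (periodicGroundStateEnergy v N L).toReal
            - (N : ℝ) * t ^ 2 / psq L k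
          ≤ (periodicEnergy v Ψ).toReal + t * cosMean L k Ψ) →
    (∀ (w : ℝ → ℝ≥0∞), Measurable w → ∀ (N : ℕ) (L : ℝ), 0 < L →
      ∀ Φ : PeriodicTrialState N L, (∀ X, Φ.ψ X = (‖Φ.ψ X‖ : ℂ)) → (∀ X, Φ.ψ X ≠ 0) →
        periodicEnergy w Φ ≠ ⊤ →
        (∀ Ψ : PeriodicTrialState N L, periodicEnergy w Ψ ≠ ⊤ →
          (periodicEnergy w Φ).toReal ≤ (periodicEnergy w Ψ).toReal) →
        ∀ Ψ : PeriodicTrialState N L, periodicEnergy w Ψ ≠ ⊤ →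
          (IsPeriodicTest L (fun X => (Ψ.ψ X).re / ‖Φ.ψ X‖) ∧
            IsPeriodicTest L (fun X => (Ψ.ψ X).im / ‖Φ.ψ X‖)) ∧
          ((∀ (σ : Equiv.Perm (Fin N)) (X : Config N),
              (fun X => (Ψ.ψ X).re / ‖Φ.ψ X‖) (X ∘ σ) = (fun X => (Ψ.ψ X).re / ‖Φ.ψ X‖) X) ∧
            (∀ (σ : Equiv.Perm (Fin N)) (X : Config N),
              (fun X => (Ψ.ψ X).im / ‖Φ.ψ X‖) (X ∘ σ) = (fun X => (Ψ.ψ X).im / ‖Φ.ψ X‖) X)) ∧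
          (∫ X in cellN N L,
              (((Ψ.ψ X).re / ‖Φ.ψ X‖) ^ 2 + ((Ψ.ψ X).im / ‖Φ.ψ X‖) ^ 2) * ‖Φ.ψ X‖ ^ 2) = 1 ∧
          (∀ k : Fin 3 → ℤ, cosMean L k Ψ =
            ∫ X in cellN N L, (∑ j, Real.cos (2 * Real.pi / L * ∑ i, (k i : ℝ) * X j i)) *
              ((((Ψ.ψ X).re / ‖Φ.ψ X‖) ^ 2 + ((Ψ.ψ X).im / ‖Φ.ψ X‖) ^ 2) * ‖Φ.ψ X‖ ^ 2)) ∧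
          (periodicEnergy w Ψ).toReal = (periodicEnergy w Φ).toReal +
            dirichletFormW L (fun X => ‖Φ.ψ X‖) (fun X => (Ψ.ψ X).re / ‖Φ.ψ X‖)
                (fun X => (Ψ.ψ X).re / ‖Φ.ψ X‖) +
              dirichletFormW L (fun X => ‖Φ.ψ X‖) (fun X => (Ψ.ψ X).im / ‖Φ.ψ X‖)
                (fun X => (Ψ.ψ X).im / ‖Φ.ψ X‖)) →
    (∀ (w : ℝ → ℝ≥0∞), Measurable w → ∀ (N : ℕ) (L : ℝ), 0 < L →
      ∀ Φ : PeriodicTrialState N L, (∀ X, Φ.ψ X = (‖Φ.ψ X‖ : ℂ)) → (∀ X, Φ.ψ X ≠ 0) →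
        periodicEnergy w Φ ≠ ⊤ →
        (∀ Ψ : PeriodicTrialState N L, periodicEnergy w Ψ ≠ ⊤ →
          (periodicEnergy w Φ).toReal ≤ (periodicEnergy w Ψ).toReal) →
        ∀ η : Config N → ℝ, IsPeriodicTest L η →
          (∀ (σ : Equiv.Perm (Fin N)) (X : Config N), η (X ∘ σ) = η X) →
          (∫ X in cellN N L, η X * ‖Φ.ψ X‖ ^ 2) = 0 →
          ((2 * Real.pi / L) ^ 2 - 2 * (periodicEnergy w Φ).toReal) *
              ∫ X in cellN N L, η X ^ 2 * ‖Φ.ψ X‖ ^ 2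
            ≤ dirichletFormW L (fun X => ‖Φ.ψ X‖) η η) →
    (∀ (N : ℕ) (L : ℝ), 0 < L → ∀ (k : Fin 3 → ℤ) (Φ : PeriodicTrialState N L),
      (∀ X, Φ.ψ X = (‖Φ.ψ X‖ : ℂ)) →
      ∀ η : Config N → ℝ, IsPeriodicTest L η →
        psq L k * |∫ X in cellN N L,
            (∑ j, Real.cos (2 * Real.pi / L * ∑ i, (k i : ℝ) * X j i)) * η X * ‖Φ.ψ X‖ ^ 2|
          ≤ Real.sqrt (N * psq L k) *
            (Real.sqrt (dirichletFormW L (fun X => ‖Φ.ψ X‖) η η) +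
              2 * Real.sqrt (∫ X in cellN N L, η X ^ 2 * ‖Φ.ψ X‖ ^ 2) *
                Real.sqrt (∫ X in cellN N L, gradDot (fun Y => ‖Φ.ψ Y‖) (fun Y => ‖Φ.ψ Y‖) X))) →
    ∀ w : ℝ → ℝ≥0∞, IsRepulsiveFiniteRange w → (∃ M : ℝ≥0∞, M ≠ ⊤ ∧ ∀ r, w r ≤ M) →
      ∀ (N : ℕ) (L : ℝ), 0 < L →
        (N : ℝ) * (periodicGroundStateEnergy w N L).toReal * L ^ 2 ≤ 4 * Real.pi ^ 2 / 5 →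
        ∀ (k : Fin 3 → ℤ), k ≠ 0 → ∀ (t : ℝ) (Ψ : PeriodicTrialState N L), periodicEnergy w Ψ ≠ ⊤ →
          (periodicGroundStateEnergy w N L).toReal - 10 * t ^ 2 * N / psq L k
            ≤ (periodicEnergy w Ψ).toReal + t * cosMean L k Ψ := by
  intro hA hD hB hC w hw hM N L hL hE k hk t Ψ hΨ
  have hP : 0 < psq L k := freeSq_psq_pos hL hk
  rcases Nat.eq_zero_or_pos N with hN0 | hNpos
  · -- `N = 0`: no particles, `⟨V⟩ = 0` and `E₀ ≤ E_w(Ψ)`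
    subst hN0
    have hcos : cosMean L k Ψ = 0 := by
      unfold cosMean
      simp
    have h0 : (periodicGroundStateEnergy w 0 L).toReal ≤ (periodicEnergy w Ψ).toReal :=
      ENNReal.toReal_mono hΨ (periodicGroundStateEnergy_le w Ψ)
    rw [hcos]
    simpa using h0
  obtain ⟨n, rfl⟩ : ∃ n, N = n + 1 := ⟨N - 1, by omega⟩
  -- the positive ground state with `t⟨V⟩ ≥ 0`
  obtain ⟨Φ, hEΦ, hfin, hreal, hpos, hsign⟩ : ∃ Φ : PeriodicTrialState (n + 1) L,
      periodicEnergy w Φ = periodicGroundStateEnergy w (n + 1) L ∧ periodicEnergy w Φ ≠ ⊤ ∧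
        (∀ X, Φ.ψ X = (‖Φ.ψ X‖ : ℂ)) ∧ (∀ X, Φ.ψ X ≠ 0) ∧ 0 ≤ t * cosMean L k Φ := by
    obtain ⟨Φ₀, hE0, hfin0, hreal0, hpos0⟩ := boundedPositiveMinimiser_holds hw hM n hL
    by_cases hs : 0 ≤ t * cosMean L k Φ₀
    · exact ⟨Φ₀, hE0, hfin0, hreal0, hpos0, hs⟩
    · obtain ⟨Φ₁, ⟨T, hT⟩, hEeq, hcos⟩ := exists_translate_cosMean_eq_neg hL hk Φ₀
      refine ⟨Φ₁, ?_, ?_, ?_, ?_, ?_⟩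
      · rw [hEeq w, hE0]
      · rw [hEeq w]; exact hfin0
      · intro X; simp only [hT]; exact hreal0 _
      · intro X; simp only [hT]; exact hpos0 _
      · rw [hcos]
        push Not at hs
        nlinarith
  set lam : ℝ := (periodicEnergy w Φ).toReal with hlamdef
  have hlamE : (periodicGroundStateEnergy w (n + 1) L).toReal = lam := by rw [hlamdef, hEΦ]
  have hlam0 : 0 ≤ lam := ENNReal.toReal_nonneg
  have hmin : ∀ Ψ' : PeriodicTrialState (n + 1) L, periodicEnergy w Ψ' ≠ ⊤ →
      (periodicEnergy w Φ).toReal ≤ (periodicEnergy w Ψ').toReal := fun Ψ' h' => by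
    rw [hEΦ]; exact ENNReal.toReal_mono h' (periodicGroundStateEnergy_le w Ψ')
  -- few-body bookkeeping
  have hNr : (1 : ℝ) ≤ ((n + 1 : ℕ) : ℝ) := by exact_mod_cast Nat.succ_le_succ (Nat.zero_le n)
  have hNr0 : (0 : ℝ) ≤ ((n + 1 : ℕ) : ℝ) := by positivity
  rw [hlamE] at hE
  obtain ⟨hNlam, hlam5⟩ := fewBody_bookkeeping hL hNr hlam0 hE
  rw [hlamE]
  by_cases htsmall : 2 * |t| * ((n + 1 : ℕ) : ℝ) ≤ (2 * Real.pi / L) ^ 2 - 2 * lam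
  · -- weak coupling: second-order perturbation theory for the two real components
    obtain ⟨⟨hθ₁, hθ₂⟩, ⟨hs₁, hs₂⟩, hnorm, hcosΨ, hener⟩ :=
      hD w hw.1 (n + 1) L hL Φ hreal hpos hfin hmin Ψ hΨ
    have hgapΦ := hB w hw.1 (n + 1) L hL Φ hreal hpos hfin hmin
    have hpairΦ := hC (n + 1) L hL k Φ hreal
    have h1 := fewBody_perturbative_real hL hw.1 hreal hpos hfin hk (Nat.succ_pos n) hgapΦ hpairΦ hsign
      hlam5 htsmall hθ₁ hs₁
    have h2 := fewBody_perturbative_real hL hw.1 hreal hpos hfin hk (Nat.succ_pos n) hgapΦ hpairΦ hsign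
      hlam5 htsmall hθ₂ hs₂
    -- notation for the two components
    set θ₁ : Config (n + 1) → ℝ := fun X => (Ψ.ψ X).re / ‖Φ.ψ X‖ with hθ₁def
    set θ₂ : Config (n + 1) → ℝ := fun X => (Ψ.ψ X).im / ‖Φ.ψ X‖ with hθ₂def
    set V : Config (n + 1) → ℝ := fun X => ∑ j, Real.cos (2 * Real.pi / L * ∑ i, (k i : ℝ) * X j i)
      with hVdef
    have hFc : Continuous fun X => ‖Φ.ψ X‖ := (contDiff_norm_of_real Φ hreal).continuous
    have hF2c : Continuous fun X => ‖Φ.ψ X‖ ^ 2 := hFc.pow 2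
    have hθ₁c : Continuous θ₁ := hθ₁.continuous
    have hθ₂c : Continuous θ₂ := hθ₂.continuous
    have hVc : Continuous V := by
      simp only [hVdef]
      fun_prop
    -- split the normalisation and the density-wave mean into the two components
    have iM₁ : IntegrableOn (fun X => θ₁ X ^ 2 * ‖Φ.ψ X‖ ^ 2) (cellN (n + 1) L) :=
      integrableOn_cellN ((hθ₁c.pow 2).mul hF2c) L
    have iM₂ : IntegrableOn (fun X => θ₂ X ^ 2 * ‖Φ.ψ X‖ ^ 2) (cellN (n + 1) L) :=
      integrableOn_cellN ((hθ₂c.pow 2).mul hF2c) L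
    have iV₁ : IntegrableOn (fun X => V X * θ₁ X ^ 2 * ‖Φ.ψ X‖ ^ 2) (cellN (n + 1) L) :=
      integrableOn_cellN ((hVc.mul (hθ₁c.pow 2)).mul hF2c) L
    have iV₂ : IntegrableOn (fun X => V X * θ₂ X ^ 2 * ‖Φ.ψ X‖ ^ 2) (cellN (n + 1) L) :=
      integrableOn_cellN ((hVc.mul (hθ₂c.pow 2)).mul hF2c) L
    have hmsum : (∫ X in cellN (n + 1) L, θ₁ X ^ 2 * ‖Φ.ψ X‖ ^ 2) +
        (∫ X in cellN (n + 1) L, θ₂ X ^ 2 * ‖Φ.ψ X‖ ^ 2) = 1 := by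
      rw [← integral_add iM₁ iM₂, ← hnorm]
      refine integral_congr_ae (ae_of_all _ fun X => ?_)
      simp only [hθ₁def, hθ₂def]
      ring
    have hVsum : cosMean L k Ψ = (∫ X in cellN (n + 1) L, V X * θ₁ X ^ 2 * ‖Φ.ψ X‖ ^ 2) +
        ∫ X in cellN (n + 1) L, V X * θ₂ X ^ 2 * ‖Φ.ψ X‖ ^ 2 := by
      rw [hcosΨ k, ← integral_add iV₁ iV₂]
      refine integral_congr_ae (ae_of_all _ fun X => ?_)
      simp only [hθ₁def, hθ₂def, hVdef]
      ring
    rw [hener, hVsum]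
    -- the two perturbative bounds, in linear form
    have h1' : -(10 * t ^ 2 * ((n + 1 : ℕ) : ℝ) / psq L k * ∫ X in cellN (n + 1) L, θ₁ X ^ 2 * ‖Φ.ψ X‖ ^ 2) ≤
        dirichletFormW L (fun X => ‖Φ.ψ X‖) θ₁ θ₁ +
          t * ∫ X in cellN (n + 1) L, V X * θ₁ X ^ 2 * ‖Φ.ψ X‖ ^ 2 := by
      have := h1
      rwa [neg_mul] at this
    have h2' : -(10 * t ^ 2 * ((n + 1 : ℕ) : ℝ) / psq L k * ∫ X in cellN (n + 1) L, θ₂ X ^ 2 * ‖Φ.ψ X‖ ^ 2) ≤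
        dirichletFormW L (fun X => ‖Φ.ψ X‖) θ₂ θ₂ +
          t * ∫ X in cellN (n + 1) L, V X * θ₂ X ^ 2 * ‖Φ.ψ X‖ ^ 2 := by
      have := h2
      rwa [neg_mul] at this
    have hc : 10 * t ^ 2 * ((n + 1 : ℕ) : ℝ) / psq L k * (∫ X in cellN (n + 1) L, θ₁ X ^ 2 * ‖Φ.ψ X‖ ^ 2) +
        10 * t ^ 2 * ((n + 1 : ℕ) : ℝ) / psq L k * (∫ X in cellN (n + 1) L, θ₂ X ^ 2 * ‖Φ.ψ X‖ ^ 2) =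
        10 * t ^ 2 * ((n + 1 : ℕ) : ℝ) / psq L k := by
      rw [← mul_add, hmsum, mul_one]
    linarith
  · -- strong coupling: the gauged square
    have hGS := hA w (n + 1) L hL k hk t Ψ hΨ
    rw [hlamE] at hGS
    push Not at htsmall
    -- `4λ ≤ 9|t|`: `N λ ≤ p₀²/5`, `3p₀²/5 ≤ g < 2|t|N`
    have hkey : 4 * lam ≤ 9 * |t| := by
      -- `N·(4λ) ≤ 4p₀²/5 ≤ (4/3)·g·… `; work with `N λ` and `|t| N`
      have h1 : 3 * (2 * Real.pi / L) ^ 2 / 5 ≤ (2 * Real.pi / L) ^ 2 - 2 * lam := by linarith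
      have h2 : 3 * (2 * Real.pi / L) ^ 2 / 5 < 2 * |t| * ((n + 1 : ℕ) : ℝ) := lt_of_le_of_lt h1 htsmall
      -- `N λ ≤ p₀²/5 < (2/3)|t| N`, hence `λ < (2/3)|t|` after dividing by `N ≥ 1`
      have h3 : ((n + 1 : ℕ) : ℝ) * lam < ((n + 1 : ℕ) : ℝ) * ((2 / 3) * |t|) := by nlinarith
      have h4 : lam < (2 / 3) * |t| := lt_of_mul_lt_mul_left h3 hNr0
      linarith [abs_nonneg t]
    exact gaugedCase_algebra hP hNr0 hlam0 hGS hkey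

end Summit.AtomisticToContinuum.BoseEinsteinCondensation.Cruxes.StaticResponseBound.FewBody

end
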